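import Summits.CriticalPhenomena.PercolationContinuityZ3.Theorems.Transplant.SkelFrmBParamsLO
import Summits.CriticalPhenomena.PercolationContinuityZ3.Theorems.Transplant.SkelNegBParamsLO
import Summits.CriticalPhenomena.PercolationContinuityZ3.Theorems.Transplant.SkelNegBParamsB
import Summits.CriticalPhenomena.PercolationContinuityZ3.Theorems.Transplant.PlanarSkeletonFrmDefs
import Summits.CriticalPhenomena.PercolationContinuityZ3.Theorems.Transplant.SkelPhiStepIDataNS
import HarnessLib

/-!
# N2 (frames-only node `SamePDropOfSkeletonFrm₁`, OPEN) params column over `PlanarSkeletonFrm` — (ζ″) ledger, shape (B′) of record ((R-14)):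
# MECHANICAL PORT of N1's `SkelNegBParamsB` — chain of record `NegB`, part B: THE BRIDGE PAIR `(M_b, n_b)` OF THE (R) COLUMN (p3-g9 ruling 2026-08-21T15:38:39Z, NEG-SCOPE
# B.13 = stmt-g13's option (b″) with its OWN zone index) — `NegB.MB D mb := max M_u mb` (slot `mb`: `:= 2Δ₀ + 26 ⊔ 22·M_u + 58` at the end, p3-g9 15:55:22Z / p5-g8
# 15:52:09Z), … (N1 title abridged; see `SkelNegBParamsB`)
builds on p205010 (kernel theorem, internal audit signed; external expert review pending) — nothing in this file uses p205010; NOTHING is claimed about the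
open node `SamePDropOfSkeletonFrm₁` (`SamePDropOfSkeletonNeg₁` is CLOSED in the tree and untouched by this file).
Status sentence (coordinator 2026-08-20T04:30Z): "θ(p_c) = 0 on ℤ^d, all d ≥ 2 — kernel-verified (Lean 4/Mathlib, standard axioms); internal adversarial
audit SIGNED 2026-08-20 04:29Z; external expert review pending."
Lane `prim-bschramm-*`, seat `prim-bschramm-stmt` (gen 19); helper file (`--supports stmt-CriticalPhenomena-4575 --as helper`); ledger HOME/prim-bschramm-stmt/FRM-PARAMS.md §9, (R-14).
PORT RULES (HOME/prim-bschramm-stmt-g19/lean/port_frm.py, the tool of record per (R-14)): outer namespace `PlanarSkeletonNeg ↦ PlanarSkeletonFrm`, carrier binder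
`(Φ : PlanarSkeletonFrm G)`, record binder `(D : Skelφ.StepI.DataNS V)` (the selectors travel IN the record, `SkelPhiStepIDataNS`); section variables INLINED into every
declaration header; inner namespaces (`Neg`/`NegB`/`KS`/…) and every short name KEPT so all cross-references resolve unchanged; declarations using no section variable are
NOT re-declared (N1's originals are referenced fully qualified). Mathematical content, proofs, docstrings and citations are N1's, verbatim, except where stated next.
SELECTORS IN THIS FILE ((R-14) condition of record — joint selection, `D.sN`'s first argument is the literal handed to `D.sM`): BRIDGE pair (generic constructor behind MBR/nBR, MBF/nBF and the face-kit pairs PxF): `MB D mb := D.sM (max (Mu D) mb)`, `nB D mb b := D.sN (max (Mu D) mb) (NegPrm.nS (D.n₁ (MB D mb)) (MB D mb) b (ρz D))` (zone floor `max M_u mb` in BOTH selectors); `bridge_pair_eq` by rfl; `MB_facts/nB_facts` gain one step.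
N1 HEADER (kept for the reader):
helper file (`--supports stmt-CriticalPhenomena-4575 --as helper`); ledger HOME/prim-bschramm-stmt/NEG-PARAMS.md v0.10;
HOME/prim-bschramm-stmt-g13/FEASIBILITY.md (why `n_s` cannot carry (R-F2): `R′ = T₀ + Lcnt + 1 > 3·As ≥ 3·n_s`).
ORDER OF CONSTANTS (acyclic, no LEVEL-0 change): `M_u → n_s → short data → kit block (Rlev, R′) → (M_b, n_b) → bridge data (h_b, ℓ_b, v_b) → M_L (box slot g ∋ 16(n_b+ℓ_b+|h_b|)) → n_L`.
* §1 `MB`, `nB`, `hB/ℓB/vB`, `MB_facts` (`M_u ≤ M_b`, `mb ≤ M_b`, `D.M₀ ≤ M_b`), `MB_floors`, `nB_facts` (`n₁ M_b ≤ n_b`, `M_b < n_b`, `b ≤ n_b`, `M_b + b + 2 + ρz ≤ n_b`), **`bridge_adm`**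
  (`D.M₀ ≤ M_b ∧ D.n₁ M_b ≤ n_b` — the pair-slot admissibility), `RF2_at`;
* §2 `oB/φB`, `lip_φB/steps_φB`, **`clauseB_of_factsO`** (`O.merged.EqGeom G φB t M_b n_b ∧ |h_b| ≤ 10·n_b`), `eqNumB_of_eqGeom`, `ℓB_ge` (`mb + 1 ≤ ℓ_b`: the one-stride room
  `ℓ_b ≥ 2Δ₀ + 27` once `mb ≥ 2Δ₀ + 26`, p5-g8 15:52:09Z needs `≥ 2Δ₀ + 24`), `MB_floors`.
[cite: KozmaNitzan2024, §4 Theorem 6 (pp. 25–31): the order of constants] [cite: MartineauTassion2017, §3.2 Lemma 3.5]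
-/

noncomputable section

open scoped Classical

namespace Summit.CriticalPhenomena.PercolationContinuityZ3.Theorems.Transplant

namespace PlanarSkeletonFrm

namespace NegB

open Literature.Probability.Percolation Literature.Probability.LatticeModels SimpleGraph
open SkelConc (Consts)
open Skelφ (oriφ trφ)
open Skelφ.StepI (DataN)
open Neg

section Bridge

/-! ## §1 The bridge zone index, width and data -/

/-- **The bridge zone index with floor slot `mb`**: `M_b := max M_u mb`. [this work] -/
def MB {V : Type} (D : Skelφ.StepI.DataNS V) (mb : ℕ) : ℕ := D.sM (max (Mu D) mb)

/-- **The bridge width with clearance slot `b`**: `n_b := max (n₁ M_b) (M_b + b + 2 + ρz)` (the landed `NegPrm.nS` at the bridge index with its `R′`-slot at `b`). [this work] -/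
def nB {V : Type} (D : Skelφ.StepI.DataNS V) (mb b : ℕ) : ℕ := D.sN (max (Mu D) mb) (Skelφ.NegPrm.nS (D.n₁ (MB D mb)) (MB D mb) b (ρz D))

/-- The bridge shear `h_b := D.hgt t M_b n_b`. [this work] -/
def hB {V : Type} (t : V) (D : Skelφ.StepI.DataNS V) (mb b : ℕ) : ℤ := D.hgt t (MB D mb) (nB D mb b)

/-- The bridge half-length `ℓ_b := D.len t M_b n_b`. [this work] -/
def ℓB {V : Type} (t : V) (D : Skelφ.StepI.DataNS V) (mb b : ℕ) : ℕ := D.len t (MB D mb) (nB D mb b)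

/-- The bridge split point `v_b := D.spl t M_b n_b`. [this work] -/
def vB {V : Type} (t : V) (D : Skelφ.StepI.DataNS V) (mb b : ℕ) : ℤ := D.spl t (MB D mb) (nB D mb b)

/-- `M_u ≤ M_b`, `mb ≤ M_b`, `D.M₀ ≤ M_b`. [folklore] -/
theorem MB_facts {V : Type} (D : Skelφ.StepI.DataNS V) (mb : ℕ) : Mu D ≤ MB D mb ∧ mb ≤ MB D mb ∧ D.M₀ ≤ MB D mb :=
  ⟨(le_max_left _ _).trans (D.le_sM _), (le_max_right _ _).trans (D.le_sM _), (M₀_le_Mu D).trans ((le_max_left _ _).trans (D.le_sM _))⟩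

/-- **The bridge width's facts**: `n₁ M_b ≤ n_b`, `M_b < n_b`, `b ≤ n_b`, `M_b + b + 2 + ρz ≤ n_b` — for EVERY `b`, in particular `b := Δ₀` read after the kit block. [folklore] -/
theorem nB_facts {V : Type} (D : Skelφ.StepI.DataNS V) (mb : ℕ) (b : ℕ) : D.n₁ (MB D mb) ≤ nB D mb b ∧ MB D mb < nB D mb b ∧ b ≤ nB D mb b ∧ MB D mb + b + 2 + ρz D ≤ nB D mb b :=
  ⟨(Skelφ.NegPrm.n₁_le_nS _ _ _ _).trans (D.le_sN _ _), (Skelφ.NegPrm.Mu_lt_nS _ _ _ _).trans_le (D.le_sN _ _),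
    (Skelφ.NegPrm.R'_le_nS _ _ _ _).1.trans (D.le_sN _ _), (Skelφ.NegPrm.floor_le_nS _ _ _ _).trans (D.le_sN _ _)⟩

/-- **The bridge pair IS the selected pair** at zone floor `max M_u mb` and width floor `NegPrm.nS (n₁ M_b) M_b b ρz` (by `rfl`; joint selection: `D.sN`'s first
argument is the literal handed to `D.sM`). [folklore] -/
theorem bridge_pair_eq {V : Type} (D : Skelφ.StepI.DataNS V) (mb : ℕ) (b : ℕ) :
    MB D mb = D.sM (max (Mu D) mb) ∧ nB D mb b = D.sN (max (Mu D) mb) (Skelφ.NegPrm.nS (D.n₁ (MB D mb)) (MB D mb) b (ρz D)) := ⟨rfl, rfl⟩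

/-- **The bridge pair is admissible** (`D.M₀ ≤ M_b`, `D.n₁ M_b ≤ n_b`) — the certificate the pair slot `Pv` carries. [folklore] -/
theorem bridge_adm {V : Type} (D : Skelφ.StepI.DataNS V) (mb : ℕ) (b : ℕ) : D.M₀ ≤ (MB D mb, nB D mb b).1 ∧ D.n₁ (MB D mb, nB D mb b).1 ≤ (MB D mb, nB D mb b).2 :=
  ⟨(MB_facts D mb).2.2, (nB_facts D mb b).1⟩

/-- **(R-F2) at the ledger's names** (exact floor, p3-g9 2026-08-21T15:55:22Z): with `b := Δ₀ := D.k + 2R′ + 1`, `Δ₀ ≤ n_b`. [folklore] -/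
theorem RF2_at {V : Type} [DecidableEq V] [Countable V] {G : SimpleGraph V} [G.LocallyFinite] (Φ : PlanarSkeletonFrm G) (t : V) (D : Skelφ.StepI.DataNS V) (mb : ℕ) (κ : Consts) (p : unitInterval) : D.k + 2 * R' κ Φ t p D + 1 ≤ nB D mb (D.k + 2 * R' κ Φ t p D + 1) :=
  (nB_facts D mb _).2.2.1

/-- **The one-stride floor through `mb`**: with `mb := max (2Δ₀ + 26) (22·M_u + 58)`, `2Δ₀ + 26 ≤ M_b` and `22·M_u + 58 ≤ M_b`. [folklore] -/
theorem MB_floors {V : Type} [DecidableEq V] [Countable V] {G : SimpleGraph V} [G.LocallyFinite] (Φ : PlanarSkeletonFrm G) (t : V) (D : Skelφ.StepI.DataNS V) (κ : Consts) (p : unitInterval) :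
    2 * (D.k + 2 * R' κ Φ t p D + 1) + 26 ≤ MB D (max (2 * (D.k + 2 * R' κ Φ t p D + 1) + 26) (22 * Mu D + 58)) ∧
      22 * Mu D + 58 ≤ MB D (max (2 * (D.k + 2 * R' κ Φ t p D + 1) + 26) (22 * Mu D + 58)) :=
  ⟨(le_max_left _ _).trans (MB_facts D _).2.1, (le_max_right _ _).trans (MB_facts D _).2.1⟩

/-! ## §2 The oriented bridge bit and map, the clause from `FactsO` -/

/-- **The bridge pair's orientation bit** `o_b := ori t M_b n_b` (values at the merged record). [this work] -/
def oB {V : Type} (t : V) (D : Skelφ.StepI.DataNS V) (DT : DataN V) (ori : V → ℕ → ℕ → Bool) (mb : ℕ) (b : ℕ) : Bool := ori t (MB (D.orient DT ori) mb) (nB (D.orient DT ori) mb b)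

/-- **The planar map the BRIDGE STEP reads**: `Φ.φ` or its transpose. [this work] -/
def φB {V : Type} {G : SimpleGraph V} [G.LocallyFinite] (Φ : PlanarSkeletonFrm G) (t : V) (D : Skelφ.StepI.DataNS V) (DT : DataN V) (ori : V → ℕ → ℕ → Bool) (mb : ℕ) (b : ℕ) : V → Site 2 := oriφ Φ.φ (oB t D DT ori mb b)

/-- `φB` is 1-Lipschitz. [folklore] -/
theorem lip_φB {V : Type} {G : SimpleGraph V} [G.LocallyFinite] (Φ : PlanarSkeletonFrm G) (t : V) (D : Skelφ.StepI.DataNS V) (DT : DataN V) (ori : V → ℕ → ℕ → Bool) (mb : ℕ) (b : ℕ) : Skelφ.Lip G (φB Φ t D DT ori mb b) := Skelφ.lip_oriφ Φ.lip _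

/-- `φB` has unit steps. [folklore] -/
theorem steps_φB {V : Type} {G : SimpleGraph V} [G.LocallyFinite] (Φ : PlanarSkeletonFrm G) (t : V) (D : Skelφ.StepI.DataNS V) (DT : DataN V) (ori : V → ℕ → ℕ → Bool) (mb : ℕ) (b : ℕ) : Skelφ.Steps G (φB Φ t D DT ori mb b) := Skelφ.steps_oriφ Φ.step _

/-- **THE BRIDGE CLAUSE FROM `FactsO`**: the merged record's geometric clause at `(M_b, n_b)` FOR THE ORIENTED MAP `φB`, and `|h_b| ≤ 10·n_b`. [this work] -/
theorem clauseB_of_factsO {V : Type} {G : SimpleGraph V} [G.LocallyFinite] (Φ : PlanarSkeletonFrm G) (t : V) (D : Skelφ.StepI.DataNS V) (DT : DataN V) (ori : V → ℕ → ℕ → Bool) (mb : ℕ) (b : ℕ) (hR : DT.R = D.R)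
    (hfacts : ∀ M, D.M₀ ≤ M → ∀ n, D.n₁ M ≤ n →
      (ori t M n = true → D.EqGeom G Φ.φ t M n ∧ (D.hgt t M n).natAbs ≤ 10 * n) ∧
      (ori t M n = false → DT.EqGeom G (trφ Φ.φ) t M n ∧ (DT.hgt t M n).natAbs ≤ 10 * n)) :
    (D.orient DT ori).EqGeom G (φB Φ t D DT ori mb b) t (MB (D.orient DT ori) mb) (nB (D.orient DT ori) mb b) ∧
      (hB t (D.orient DT ori) mb b).natAbs ≤ 10 * nB (D.orient DT ori) mb b :=
  Skelφ.StepI.orient_clause_all hR hfacts _ (MB_facts _ mb).2.2 _ (nB_facts _ mb b).1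

/-- **The bridge pair's geometric facts unpacked** (ℤ shapes), for ANY map. [folklore] -/
theorem eqNumB_of_eqGeom {V : Type} {G : SimpleGraph V} [G.LocallyFinite] (t : V) (D : Skelφ.StepI.DataNS V) (mb : ℕ) (b : ℕ) (ψ : V → Site 2) (hE : D.EqGeom G ψ t (MB D mb) (nB D mb b)) :
    MB D mb < nB D mb b ∧ MB D mb < ℓB t D mb b ∧ |vB t D mb b| ≤ (nB D mb b : ℤ) ∧
      ((MB D mb : ℤ) + 1) * ((nB D mb b : ℤ) + |hB t D mb b|) ≤ (nB D mb b : ℤ) * ((ℓB t D mb b : ℤ) + 1) :=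
  eqGeom_num_of t D ψ hE

/-- **The one-stride room**: `mb + 1 ≤ ℓ_b` (from `M_b < ℓ_b`; with `mb ≥ 2Δ₀ + 26` this is `ℓ_b ≥ 2Δ₀ + 27 ≥ 2Δ₀ + 25`, p3-g9 15:55:22Z / p5-g8 15:52:09Z). [folklore] -/
theorem ℓB_ge {V : Type} {G : SimpleGraph V} [G.LocallyFinite] (t : V) (D : Skelφ.StepI.DataNS V) (mb : ℕ) (b : ℕ) (ψ : V → Site 2) (hE : D.EqGeom G ψ t (MB D mb) (nB D mb b)) : mb + 1 ≤ ℓB t D mb b :=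
  (Nat.succ_le_of_lt (lt_of_le_of_lt (MB_facts D mb).2.1 (eqNumB_of_eqGeom t D mb b ψ hE).2.1))

end Bridge

end NegB

end PlanarSkeletonFrm

end Summit.CriticalPhenomena.PercolationContinuityZ3.Theorems.Transplant

end
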